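import Summits.AtomisticToContinuum.HydrodynamicLimit.Theorems.ImplosionDichotomyPolynomialCompressionLevel3Defs
import Summits.AtomisticToContinuum.HydrodynamicLimit.Theorems.ImplosionDichotomyPolynomialCompressionLevel2Forcing
import Summits.AtomisticToContinuum.HydrodynamicLimit.Theorems.ImplosionDichotomyPolynomialCompressionFrozenEnergyIdentity
import Summits.AtomisticToContinuum.HydrodynamicLimit.Theorems.ImplosionDichotomyPolynomialCompressionQuadraticPointwise
import Summits.AtomisticToContinuum.HydrodynamicLimit.Theorems.ImplosionDichotomyPolynomialCompressionIsentropicCalculus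
import Summits.AtomisticToContinuum.HydrodynamicLimit.Theorems.ImplosionDichotomyPolynomialCompressionWeightTransport
import Summits.AtomisticToContinuum.HydrodynamicLimit.Theorems.ImplosionDichotomyPolynomialCompressionLevel3PairingBound

/-!
# Level-3 pointwise energy balance for one word (line `log-lipschitz-budget`, stub 4, level 3)

Helper file for the crux `ImplosionDichotomy.PolynomialCompression` (stmt-AtomisticToContinuum-12587), stub
`stub_logBudgetShadowing` (vocabulary `…Level3Defs`). For a word `(l,m,n)` and `W = ∂ₙ∂ₘ∂ₗ δV`, the frozen energy
identity (`hsEuler_frozen_energy_identity` at `(α, w, β) = W`, with the weight transports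
`hsEuler_weightA/B_transport` and coefficient gradients `hsEuler_coeffRho/Theta_partialDeriv`), the Type-I bound of its
quadratic coefficients (`frozen_quadratic_pointwise_bound`) and the pairing bound `level3_pairing_bound` give
`∂ₜ l3e + Σᵢ ∂ᵢ l3flux ≤ (Λ/λ)(l3e + l3Y) + 3 · l3Nw · l3Ws · l3Rem` at every point of the weak bootstrap regime.
-/

noncomputable section

namespace Summit.AtomisticToContinuum.HydrodynamicLimit.Theorems

open Set MeasureTheory
open Literature.MathematicalPhysics.KineticTheory Literature.Analysis.FunctionSpaces

/-- Coordinates commute with first partial derivatives of `C¹` vector fields and are dominated by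
the Euclidean norm: `|∂ᵢ(vⱼ)(x) - ∂ᵢ(v'ⱼ)(x)| ≤ ‖∂ᵢv(x) - ∂ᵢv'(x)‖`. [folklore] -/
private theorem l3bal_abs_coord_sub_le {v v' : T3 → V3} (hv : Torus.IsContDiff 1 v)
    (hv' : Torus.IsContDiff 1 v') (i j : Fin 3) (x : T3) :
    |Torus.partialDeriv i (fun y => v y j) x - Torus.partialDeriv i (fun y => v' y j) x| ≤
      ‖Torus.partialDeriv i v x - Torus.partialDeriv i v' x‖ := by
  -- adapted from `abs_partialDeriv_coord_sub_le` (…Level0Shadowing)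
  rw [Torus.partialDeriv_apply_coord hv, Torus.partialDeriv_apply_coord hv', ← PiLp.sub_apply,
    ← Real.norm_eq_abs]
  exact PiLp.norm_apply_le _ j

/-- In the packing regime `η (c_Z + 1) ≤ 1/8` the coefficient `γ = ζ0 + ζ1` is positive. [folklore] -/
private theorem l3bal_gamma_pos {z0 z1 cZ η : ℝ} (h0 : |z0 - 1| ≤ cZ * η) (h1 : |z1| ≤ cZ * η)
    (hη : 0 ≤ η) (hp : η * (cZ + 1) ≤ 1 / 8) : 0 < z0 + z1 := by
  have hc : cZ * η ≤ 1 / 8 := by nlinarith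
  rw [abs_le] at h0 h1
  linarith [h0.1, h1.1]

/-- The energy density `l3e` is nonnegative wherever `ρ, θ > 0` and `γ(ρ) ≥ 0`. [folklore] -/
private theorem l3bal_l3e_nonneg {ζ : ℝ → ℝ} {ρ θ ρ₁ θ₁ : ℝ → T3 → ℝ} {u u₁ : ℝ → T3 → V3}
    {s : ℝ} {y : T3} (hρ : 0 < ρ s y) (hθ : 0 < θ s y)
    (hγ : 0 ≤ ζ (ρ s y) + ρ s y * deriv ζ (ρ s y)) (a b c : Fin 3) :
    0 ≤ l3e ζ ρ θ ρ₁ θ₁ u u₁ a b c s y := by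
  unfold l3e
  positivity

/-- **Level-3 pointwise balance for one word** (see the module docstring). [folklore] -/
theorem level3_pointwise_balance :
    ∀ (K C Cb cZ : ℝ), 0 < K → 0 ≤ C → 0 ≤ Cb → 0 ≤ cZ →
      ∃ Λ : ℝ, 0 ≤ Λ ∧
        ∀ {σ T T₁ : ℝ} {ρ θ ρ₁ θ₁ : ℝ → T3 → ℝ} {u u₁ : ℝ → T3 → V3} {ζ : ℝ → ℝ} {J : Set ℝ},
          IsHardSphereEulerSolution σ T ρ u θ → IsHardSphereEulerSolution 0 T ρ₁ u₁ θ₁ →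
          0 < σ → T ≤ T₁ →
          IsOpen J → ContDiffOn ℝ (⊤ : ℕ∞) ζ J → (∀ t ∈ Ico 0 T, ∀ x, ρ t x ∈ J) →
          (∀ t ∈ Ico 0 T, ∀ x, hsPressure σ (ρ t x) (θ t x) = ρ t x * θ t x * ζ (ρ t x)) →
          (∀ t ∈ Ico 0 T, ∀ x, |ζ (ρ t x) - 1| ≤ cZ * (ρ t x * σ ^ 3) ∧
            |ρ t x * deriv ζ (ρ t x)| ≤ cZ * (ρ t x * σ ^ 3) ∧
            |ρ t x ^ 2 * deriv (deriv ζ) (ρ t x)| ≤ cZ * (ρ t x * σ ^ 3)) →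
          (∀ t ∈ Ico 0 T, ∀ x, θ₁ t x = K * ρ₁ t x ^ (2 / 3 : ℝ)) →
          (∀ t ∈ Ico 0 T, ∀ x, ∀ i : Fin 3,
            ‖Torus.partialDeriv i (u₁ t) x‖ ≤ C / (T₁ - t) ∧
            |Torus.partialDeriv i (fun y => ρ₁ t y ^ (1 / 3 : ℝ)) x| ≤ C / (T₁ - t)) →
          (∀ t ∈ Ico 0 T, ∀ x, |ρ t x - ρ₁ t x| ≤ ρ₁ t x / 2 ∧ |θ t x - θ₁ t x| ≤ θ₁ t x / 2 ∧
            ρ t x * σ ^ 3 * (cZ + 1) ≤ 1 / 8) →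
          (∀ t ∈ Ico 0 T, ∀ x, ∀ i : Fin 3,
            ‖Torus.partialDeriv i (u t) x - Torus.partialDeriv i (u₁ t) x‖ ≤ Cb / (T₁ - t) ∧
            Real.sqrt (θ₁ t x) *
                |Torus.partialDeriv i (ρ t) x - Torus.partialDeriv i (ρ₁ t) x| / ρ₁ t x ≤
              Cb / (T₁ - t) ∧
            |Torus.partialDeriv i (θ t) x - Torus.partialDeriv i (θ₁ t) x| / Real.sqrt (θ₁ t x) ≤
              Cb / (T₁ - t)) →
          ∀ {t : ℝ}, t ∈ Ico 0 T → ∀ (x : T3) {M Z S₂ S₃ d₀ d₁ d₂ : ℝ},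
          0 ≤ M → 0 ≤ Z → 0 ≤ S₂ → 0 ≤ S₃ → 0 ≤ d₀ → 0 ≤ d₁ → 0 ≤ d₂ →
          Level3Coeff ζ ρ θ ρ₁ θ₁ u u₁ t x M Z S₂ S₃ → Level3Jets ρ θ ρ₁ θ₁ u u₁ t x d₀ d₁ d₂ →
          ∀ (l m n : Fin 3),
          Torus.timeDerivWithin (Ico 0 T) (l3e ζ ρ θ ρ₁ θ₁ u u₁ l m n) t x +
            ∑ i, Torus.partialDeriv i (l3flux ζ ρ θ ρ₁ θ₁ u u₁ t l m n i) x
          ≤ Λ / (T₁ - t) * (l3e ζ ρ θ ρ₁ θ₁ u u₁ l m n t x + l3Y ζ ρ θ ρ₁ θ₁ u u₁ t x l m n) +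
            3 * l3Nw ζ ρ θ ρ₁ θ₁ u u₁ t x l m n * l3Ws ζ ρ θ t x * l3Rem M Z S₂ S₃ d₀ d₁ d₂ := by
  intro K C Cb cZ hK hC hCb hcZ
  obtain ⟨Λ₁, hΛ₁, H⟩ := frozen_quadratic_pointwise_bound K C Cb cZ hK hC hCb hcZ
  obtain ⟨Λ₂, hΛ₂, P⟩ := level3_pairing_bound K C Cb cZ hK hC hCb hcZ
  refine ⟨Λ₁ + Λ₂, add_nonneg hΛ₁ hΛ₂, ?_⟩
  intro σ T T₁ ρ θ ρ₁ θ₁ u u₁ ζ J hE hE₁ hσ hTT₁ hJ hζ hρJ hp hEos hIsen hTI hB0 hB1 t ht x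
    M Z S₂ S₃ d₀ d₁ d₂ hM hZ hS₂ hS₃ hd₀ hd₁ hd₂ hCo hJe l m n
  have hlam : 0 < T₁ - t := sub_pos.2 (ht.2.trans_le hTT₁)
  have hρ0 : 0 < ρ t x := hE.density_pos t ht x
  have hθ0 : 0 < θ t x := hE.temperature_pos t ht x
  have hρ₁0 : 0 < ρ₁ t x := hE₁.density_pos t ht x
  have hu1 : Torus.IsContDiff 1 (u t) := (hE.smooth_velocity.isSmooth_slice ht).isContDiff (by simp)
  have hu₁1 : Torus.IsContDiff 1 (u₁ t) :=
    (hE₁.smooth_velocity.isSmooth_slice ht).isContDiff (by simp)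
  have hUD : UniqueDiffOn ℝ (Ico (0 : ℝ) T) := uniqueDiffOn_Ico 0 T
  -- the pairing part (neighbour `level3_pairing_bound`)
  have hP := P hE hE₁ hσ hTT₁ hJ hζ hρJ hp hEos hIsen hTI hB0 hB1 ht x hM hZ hS₂ hS₃ hd₀ hd₁ hd₂
    hCo hJe l m n
  unfold l3Fρ l3Fu l3Fθ at hP
  -- (1) the frozen identity with `W = ∂ₙ∂ₘ∂ₗ δV`
  have hF := hsEuler_frozen_energy_identity hE hJ hζ hρJ
    ((((hE.smooth_density.sub hE₁.smooth_density).partialDeriv hUD l).partialDeriv hUD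
      m).partialDeriv hUD n)
    ((((hE.smooth_velocity.sub hE₁.smooth_velocity).partialDeriv hUD l).partialDeriv hUD
      m).partialDeriv hUD n)
    ((((hE.smooth_temperature.sub hE₁.smooth_temperature).partialDeriv hUD l).partialDeriv hUD
      m).partialDeriv hUD n) ht x
  have hF' : Torus.timeDerivWithin (Ico 0 T) (l3e ζ ρ θ ρ₁ θ₁ u u₁ l m n) t x +
      ∑ i, Torus.partialDeriv i (l3flux ζ ρ θ ρ₁ θ₁ u u₁ t l m n i) x = _ := hF
  rw [hF']
  -- (2)-(3) the coefficient groups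
  rw [hsEuler_weightA_transport hE hJ hζ hρJ hp ht x, hsEuler_weightB_transport hE hJ hζ hρJ hp ht x]
  simp only [hsEuler_coeffRho_partialDeriv hE hJ hζ hρJ ht x,
    hsEuler_coeffTheta_partialDeriv hE hJ hζ hρJ ht x]
  -- (4) the isentropic reference through `c₁ = ρ₁^{1/3}`
  obtain ⟨hc₁, hρ₁c, hθ₁c, hsq⟩ := isentropic_pointwise_algebra hK hρ₁0 (hIsen t ht x)
  have hdρ₁ := isentropic_partialDeriv_density hE₁ ht x
  have hdθ₁ := isentropic_partialDeriv_temperature hE₁ hK hIsen ht x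
  generalize hc₁def : ρ₁ t x ^ (1 / 3 : ℝ) = c₁ at hc₁ hρ₁c hθ₁c hsq hdρ₁ hdθ₁
  -- the hypotheses of the quadratic pointwise lemma
  obtain ⟨hB0a, hB0b, hB0c⟩ := hB0 t ht x
  rw [hρ₁c] at hB0a; rw [hθ₁c] at hB0b
  obtain ⟨hE1, hE2, hE3⟩ := hEos t ht x
  have hdu₁ : ∀ i j, |Torus.partialDeriv i (fun y => u₁ t y j) x| ≤ C / (T₁ - t) := fun i j => by
    rw [Torus.partialDeriv_apply_coord hu₁1, ← Real.norm_eq_abs]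
    exact (PiLp.norm_apply_le _ j).trans (hTI t ht x i).1
  have hdu : ∀ i j, |Torus.partialDeriv i (fun y => u t y j) x -
      Torus.partialDeriv i (fun y => u₁ t y j) x| ≤ Cb / (T₁ - t) :=
    fun i j => (l3bal_abs_coord_sub_le hu1 hu₁1 i j x).trans (hB1 t ht x i).1
  have hdc₁ : ∀ i, |Torus.partialDeriv i (fun y => ρ₁ t y ^ (1 / 3 : ℝ)) x| ≤ C / (T₁ - t) :=
    fun i => (hTI t ht x i).2
  have hdρ : ∀ i, Real.sqrt K * c₁ * |Torus.partialDeriv i (ρ t) x -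
      3 * c₁ ^ 2 * Torus.partialDeriv i (fun y => ρ₁ t y ^ (1 / 3 : ℝ)) x| / c₁ ^ 3 ≤
      Cb / (T₁ - t) := by
    intro i; have h := (hB1 t ht x i).2.1; rwa [hsq, hdρ₁ i, hρ₁c] at h
  have hdθ : ∀ i, |Torus.partialDeriv i (θ t) x -
      2 * K * c₁ * Torus.partialDeriv i (fun y => ρ₁ t y ^ (1 / 3 : ℝ)) x| / (Real.sqrt K * c₁) ≤
      Cb / (T₁ - t) := by
    intro i; have h := (hB1 t ht x i).2.2; rwa [hsq, hdθ₁ i] at h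
  have hH := H (T₁ - t) c₁ (ρ t x) (θ t x) (ζ (ρ t x)) (ρ t x * deriv ζ (ρ t x))
    (ρ t x ^ 2 * deriv (deriv ζ) (ρ t x)) (ρ t x * σ ^ 3)
    (fun i j => Torus.partialDeriv i (fun y => u t y j) x)
    (fun i j => Torus.partialDeriv i (fun y => u₁ t y j) x)
    (fun i => Torus.partialDeriv i (fun y => ρ₁ t y ^ (1 / 3 : ℝ)) x)
    (fun i => Torus.partialDeriv i (ρ t) x) (fun i => Torus.partialDeriv i (θ t) x)
    (Torus.partialDeriv n (Torus.partialDeriv m (Torus.partialDeriv l (fun y => ρ t y - ρ₁ t y))) x)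
    (Torus.partialDeriv n (Torus.partialDeriv m (Torus.partialDeriv l (fun y => θ t y - θ₁ t y))) x)
    (fun i => Torus.partialDeriv n (Torus.partialDeriv m (Torus.partialDeriv l
      (fun y => u t y - u₁ t y))) x i)
    hlam hc₁ (by positivity) hB0c hE1 hE2 hE3 hB0a hB0b hdu₁ hdu hdc₁ hdρ hdθ
  beta_reduce at hH
  have e1 : θ t x * (2 * (ρ t x * deriv ζ (ρ t x)) + ρ t x ^ 2 * deriv (deriv ζ) (ρ t x)) / ρ t x =
      θ t x * (2 * deriv ζ (ρ t x) + ρ t x * deriv (deriv ζ) (ρ t x)) := by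
    rw [div_eq_iff hρ0.ne']
    ring
  rw [e1] at hH
  -- the energies: `‖W_u‖² = Σ W_uᵢ²`, `l3e = ½(…)`, `l3Y ≥ 0`
  have hnorm : ‖Torus.partialDeriv n (Torus.partialDeriv m (Torus.partialDeriv l
      (fun y => u t y - u₁ t y))) x‖ ^ 2 =
      Torus.partialDeriv n (Torus.partialDeriv m (Torus.partialDeriv l (fun y => u t y - u₁ t y))) x 0 ^ 2 +
      Torus.partialDeriv n (Torus.partialDeriv m (Torus.partialDeriv l (fun y => u t y - u₁ t y))) x 1 ^ 2 +
      Torus.partialDeriv n (Torus.partialDeriv m (Torus.partialDeriv l (fun y => u t y - u₁ t y))) x 2 ^ 2 := by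
    simp only [EuclideanSpace.norm_sq_eq, Fin.sum_univ_three, Real.norm_eq_abs, sq_abs]
  have hEeq : l3e ζ ρ θ ρ₁ θ₁ u u₁ l m n t x = 1 / 2 *
      (θ t x * (ζ (ρ t x) + ρ t x * deriv ζ (ρ t x)) / ρ t x *
        Torus.partialDeriv n (Torus.partialDeriv m (Torus.partialDeriv l (fun y => ρ t y - ρ₁ t y))) x ^ 2 +
      ρ t x * ‖Torus.partialDeriv n (Torus.partialDeriv m (Torus.partialDeriv l
        (fun y => u t y - u₁ t y))) x‖ ^ 2 +
      3 / 2 * ρ t x / θ t x *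
        Torus.partialDeriv n (Torus.partialDeriv m (Torus.partialDeriv l (fun y => θ t y - θ₁ t y))) x ^ 2) :=
    rfl
  have hγ : 0 < ζ (ρ t x) + ρ t x * deriv ζ (ρ t x) := l3bal_gamma_pos hE1 hE2 (by positivity) hB0c
  have hY : 0 ≤ Λ₁ / (T₁ - t) * l3Y ζ ρ θ ρ₁ θ₁ u u₁ t x l m n := by
    refine mul_nonneg (div_nonneg hΛ₁ hlam.le) (Finset.sum_nonneg fun i _ => ?_)
    exact add_nonneg (add_nonneg (l3bal_l3e_nonneg hρ0 hθ0 hγ.le _ _ _)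
      (l3bal_l3e_nonneg hρ0 hθ0 hγ.le _ _ _)) (l3bal_l3e_nonneg hρ0 hθ0 hγ.le _ _ _)
  rw [hnorm] at hEeq
  simp only [Fin.sum_univ_three] at hH hP ⊢
  linear_combination hH + hP + hY - (Λ₁ / (T₁ - t)) * hEeq

end Summit.AtomisticToContinuum.HydrodynamicLimit.Theorems

end
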